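import Mathlib
import Literature.NumberTheory.Transcendental.KZCalculusProofs
import Literature.NumberTheory.Transcendental.KZLogCalculusProofs
import Literature.NumberTheory.Transcendental.KZSemiCanonicalReductionProofs
import Summits.KontsevichZagierPeriods.KontsevichZagierPeriods.Theorems.HyperbolicBlochOffTetraSectorKernelStubSimilarityMove
import Summits.KontsevichZagierPeriods.KontsevichZagierPeriods.Theorems.HyperbolicBlochOffTetraSectorKernelStubThreeTrianglesAux
import Summits.KontsevichZagierPeriods.KontsevichZagierPeriods.Theorems.LinRedNormalFormArrangementNormalFormStubRebaseOneTools

/-!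
# `OffTetraSectorKernel`, line `odd-hyperbolic-ladder`: the three-triangle relation (stub `stub_threeTriangles`)

Rung 1 of the hyperbolic scissors ladder: areas of `ℚ̄`-geodesic polygons of the hyperbolic plane (upper
half-plane `{p : Fin 2 → ℝ | 0 < p 1}`, `x = p 0`, `t = p 1`, area density `1/t²`). The standard doubly-ideal
triangle `Std γ = V γ 1 0 1 = {γ < x < 1, 0 < t, 1 < x² + t²}` has vertices `∞`, `1` and `(γ, √(1 − γ²))` and
area `arccos γ`. The **three-triangle relation**: for `A = arccos a`, `B = arccos b` with `A + B ≤ π`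
(`⇔ 0 ≤ a + b`) and `C = π − A − B`, `cos C = √(1−a²)√(1−b²) − ab`,

`[Std a] + [Std b] + [Std (cos C)] − [Std (−1)] ∈ KZ.relations`

for ANY representations of these four areas with integrand `t⁻²` (value-wise: `A + B + C = π`).

Proof (three moves and two cuts, no value is ever computed). Write `c' = cos (A + B) = ab − √(1−a²)√(1−b²)`
(`= threeTri_g a b`, so `cos C = −c'`), and let `r₁, r₂, r₃` be the restrictions of the ideal-triangle
representation `rπ = [Std(−1), t⁻²]` to the V-pieces over `(c', b)`, `(c', 1)`, `(−1, c')`.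
* `[Std a] ≡ [r₁]`: the boundary ROTATION by the angle `B` (`x = cos θ ↦ cos(θ + B)`, extended to the
  half-plane with the Jacobian factor; file `…StubThreeTrianglesAux`, `threeTri_rotationMove`) is one
  change of variables (rule (2)) carrying `Std a` (boundary arc `θ ∈ (0, A)`) onto the V-piece over
  `(cos(A+B), cos B)` (arc `θ ∈ (B, A+B)`);
* `[r₂] ≡ [r₁] + [Std b]` and `[Std(−1)] ≡ [r₃] + [r₂]`: vertical cuts at `x = b`, `x = c'` (rule (1a); the
  walls `{x = const}` are Lebesgue-null);
* `[r₃] ≡ [Std (cos C)]`: the reflection `x ↦ −x` (a boundary similarity, landed `stub_similarityMove`) maps the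
  V-piece over `(−1, c')` onto `Std(−c')`.
Adding up, `[Std a] + [Std b] + [Std(−c')] − [Std(−1)] = E₁ − E₂ − E₃ − E₄ ∈ relations`.

References: M. Kontsevich, D. Zagier, *Periods* (2001), §1.1 (the `π` example), §1.2 rules (1), (2).
-/

noncomputable section

open Set MeasureTheory MvPolynomial
open Literature.NumberTheory.Transcendental Literature.ModelTheory.ExponentialFields

namespace Summit.KontsevichZagierPeriods.HyperbolicBloch.OffTetraSectorKernel

/-! ### Vertical cuts of V-pieces over the unit circle -/

/-- The V-pieces `{α < x < β, 0 < t, 1 < x² + t²}` over the unit circle with real algebraic `α, β` are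
`ℚ`-semialgebraic. [cite: KontsevichZagier2001, §1.1] -/
theorem threeTri_isSemialgebraic_V {α β : ℝ} (hα : IsAlgebraic ℚ α) (hβ : IsAlgebraic ℚ β) :
    IsSemialgebraic ℚ {p : Fin 2 → ℝ | α < p 0 ∧ p 0 < β ∧ 0 < p 1 ∧ 1 < (p 0 - 0) ^ 2 + p 1 ^ 2} := by
  have hU : IsSemialgebraic ℚ (univ : Set (Fin 2 → ℝ)) := isSemialgebraic_univ
  have hx : ∀ i : Fin 2, IsSemialgebraicFunOn ℚ (univ : Set (Fin 2 → ℝ)) (fun p => p i) :=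
    fun i => isSemialgebraicFunOn_apply_univ i
  have hc : ∀ {c : ℝ}, IsAlgebraic ℚ c → IsSemialgebraicFunOn ℚ (univ : Set (Fin 2 → ℝ)) (fun _ => c) :=
    fun hc => isSemialgebraicFunOn_const_of_isAlgebraic hU hc
  have hq : IsSemialgebraicFunOn ℚ (univ : Set (Fin 2 → ℝ)) (fun p => (p 0 - 0) ^ 2 + p 1 ^ 2) :=
    (isSemialgebraicFunOn_aeval hU (X 0 ^ 2 + X 1 ^ 2 : MvPolynomial (Fin 2) ℚ)).congr fun p _ => by simp
  have S1 : IsSemialgebraic ℚ {p : Fin 2 → ℝ | α < p 0} :=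
    isSemialgebraic_setOf_lt_of_isSemialgebraicFunOn (hc hα) (hx 0)
  have S2 : IsSemialgebraic ℚ {p : Fin 2 → ℝ | p 0 < β} :=
    isSemialgebraic_setOf_lt_of_isSemialgebraicFunOn (hx 0) (hc hβ)
  have S3 : IsSemialgebraic ℚ {p : Fin 2 → ℝ | 0 < p 1} :=
    isSemialgebraic_setOf_lt_of_isSemialgebraicFunOn (hc isAlgebraic_zero) (hx 1)
  have S4 : IsSemialgebraic ℚ {p : Fin 2 → ℝ | 1 < (p 0 - 0) ^ 2 + p 1 ^ 2} :=
    isSemialgebraic_setOf_lt_of_isSemialgebraicFunOn (hc isAlgebraic_one) hq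
  convert S1.inter (S2.inter (S3.inter S4)) using 1
  ext p
  simp only [mem_setOf_eq, mem_inter_iff]

/-- **Vertical cut** (rule (1a)): if `r, r₁, r₂` represent `t⁻²` over the V-pieces on `(α, β)`, `(α, m)`, `(m, β)`
with `α ≤ m ≤ β`, then `[r] − [r₁] − [r₂] ∈ KZ.relations` (the pieces partition `r.domain` off the null wall
`{x = m}` — `RebaseOne.volume_vline`; iterated domain additivity `KZ.of_sub_sum_of_mem_relations`).
[cite: KontsevichZagier2001, §1.2 rule (1)] -/
theorem threeTri_split {α m β : ℝ} (hαm : α ≤ m) (hmβ : m ≤ β) (r r₁ r₂ : KZ.IntegralRep 2)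
    (hr : r.domain = {p | α < p 0 ∧ p 0 < β ∧ 0 < p 1 ∧ 1 < (p 0 - 0) ^ 2 + p 1 ^ 2})
    (hr₁ : r₁.domain = {p | α < p 0 ∧ p 0 < m ∧ 0 < p 1 ∧ 1 < (p 0 - 0) ^ 2 + p 1 ^ 2})
    (hr₂ : r₂.domain = {p | m < p 0 ∧ p 0 < β ∧ 0 < p 1 ∧ 1 < (p 0 - 0) ^ 2 + p 1 ^ 2})
    (hi : EqOn r.integrand (fun p => 1 / p 1 ^ 2) r.domain)
    (hi₁ : EqOn r₁.integrand (fun p => 1 / p 1 ^ 2) r₁.domain)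
    (hi₂ : EqOn r₂.integrand (fun p => 1 / p 1 ^ 2) r₂.domain) :
    KZ.of r - KZ.of r₁ - KZ.of r₂ ∈ KZ.relations := by
  classical
  set R : Fin 2 → KZ.IntegralRep 2 := ![r₁, r₂] with hR
  have hR0 : R 0 = r₁ := rfl
  have hR1 : R 1 = r₂ := rfl
  have hsub : ∀ i, (R i).domain ⊆ r.domain := by
    rw [Fin.forall_fin_two, hR0, hR1, hr, hr₁, hr₂]
    exact ⟨fun p hp => ⟨hp.1, by linarith [hp.2.1], hp.2.2⟩, fun p hp => ⟨by linarith [hp.1], hp.2.1, hp.2.2⟩⟩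
  have hint : ∀ i, EqOn (R i).integrand (fun p => 1 / p 1 ^ 2) (R i).domain := by
    rw [Fin.forall_fin_two, hR0, hR1]
    exact ⟨hi₁, hi₂⟩
  have h12 : r₁.domain ∩ r₂.domain = ∅ := by
    rw [hr₁, hr₂]
    exact eq_empty_of_forall_notMem fun p hp => by
      have h1 := hp.1.2.1
      have h2 := hp.2.1
      linarith
  have hcov : volume (r.domain \ ⋃ i ∈ (Finset.univ : Finset (Fin 2)), (R i).domain) = 0 := by
    refine measure_mono_null (fun p hp => ?_)
      (Summit.KontsevichZagierPeriods.ArrangementNormalForm.JanusBands.RebaseOne.volume_vline m)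
    obtain ⟨hp, hp'⟩ := hp
    simp only [Finset.mem_univ, iUnion_true, mem_iUnion, not_exists] at hp'
    rw [hr] at hp
    rcases lt_trichotomy (p 0) m with h | h | h
    · exact absurd (show p ∈ (R 0).domain by rw [hR0, hr₁]; exact ⟨hp.1, h, hp.2.2⟩) (hp' 0)
    · exact h
    · exact absurd (show p ∈ (R 1).domain by rw [hR1, hr₂]; exact ⟨h, hp.2.1, hp.2.2⟩) (hp' 1)
  have hdisj : ((Finset.univ : Finset (Fin 2)) : Set (Fin 2)).Pairwise
      (fun i j => volume ((R i).domain ∩ (R j).domain) = 0) := by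
    intro i _ j _ hij
    fin_cases i <;> fin_cases j
    · exact absurd rfl hij
    · show volume ((R 0).domain ∩ (R 1).domain) = 0
      rw [hR0, hR1, h12, measure_empty]
    · show volume ((R 1).domain ∩ (R 0).domain) = 0
      rw [hR0, hR1, inter_comm, h12, measure_empty]
    · exact absurd rfl hij
  have h := KZ.of_sub_sum_of_mem_relations (Finset.univ : Finset (Fin 2)) r R
    (fun i _ => measure_mono_null (fun p hp => (hp.2 (hsub i hp.1)).elim) measure_empty)
    (fun i _ p hp => by rw [hint i hp.1, hi hp.2]) hcov hdisj
  rw [Fin.sum_univ_two, hR0, hR1, ← sub_sub] at h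
  exact h

/-! ### The reflection `x ↦ −x` -/

/-- The boundary similarity with `c = 1`, `A = −1`, `b = 0` is the reflection `(x, t) ↦ (−x, t)`. [folklore] -/
theorem threeTri_reflect_apply (p : Fin (1 + 1) → ℝ) :
    (Fin.snoc (α := fun _ => ℝ) ((1 : ℝ) • (-1 : Matrix (Fin 1) (Fin 1) ℝ).mulVec (Fin.init p) + 0)
      (1 * p (Fin.last 1)) : Fin (1 + 1) → ℝ) = ![-p 0, p 1] := by
  ext i
  fin_cases i
  · simp [Fin.snoc, Fin.init, Matrix.mulVec, dotProduct]
  · simp [Fin.snoc]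

/-- **Reflection move**: if `r` represents `t⁻²` over the V-piece on `(α, β)` and `r'` represents `t⁻²` over the
V-piece on `(−β, −α)`, then `KZ.Equivalent r r'` — the reflection `x ↦ −x` is a boundary similarity of the
half-plane (landed `stub_similarityMove` with `n = 1`, `c = 1`, `A = −1`, `b = 0`). [cite: KontsevichZagier2001, §1.2 rule (2)] -/
theorem threeTri_reflect {α β α' β' : ℝ} (hα' : α' = -β) (hβ' : β' = -α) (r r' : KZ.IntegralRep 2)
    (hr : r.domain = {p | α < p 0 ∧ p 0 < β ∧ 0 < p 1 ∧ 1 < (p 0 - 0) ^ 2 + p 1 ^ 2})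
    (hi : EqOn r.integrand (fun p => 1 / p 1 ^ 2) r.domain)
    (hr' : r'.domain = {p | α' < p 0 ∧ p 0 < β' ∧ 0 < p 1 ∧ 1 < (p 0 - 0) ^ 2 + p 1 ^ 2})
    (hi' : EqOn r'.integrand (fun p => 1 / p 1 ^ 2) r'.domain) : KZ.Equivalent r r' := by
  subst hα' hβ'
  have hA : ∀ i j : Fin 1, IsAlgebraic ℚ ((-1 : Matrix (Fin 1) (Fin 1) ℝ) i j) := fun i j => by
    fin_cases i; fin_cases j
    simpa using isAlgebraic_one.neg
  refine stub_similarityMove 1 1 (-1) 0 isAlgebraic_one one_pos hA (by simp) (fun _ => isAlgebraic_zero)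
    r r' (fun p hp => ?_) (fun p hp => ?_) ?_ (fun p hp => ?_)
  · rw [hr] at hp
    exact hp.2.2.1
  · rw [hi hp]
    rfl
  · rw [hr', hr]
    ext q
    simp only [mem_image, mem_setOf_eq, threeTri_reflect_apply]
    constructor
    · rintro ⟨h1, h2, h3, h4⟩
      refine ⟨![-q 0, q 1], ⟨by simp; linarith, by simp; linarith, by simpa using h3, ?_⟩, ?_⟩
      · simp only [Matrix.cons_val_zero, Matrix.cons_val_one]
        nlinarith
      · ext i
        fin_cases i <;> simp
    · rintro ⟨p, ⟨h1, h2, h3, h4⟩, rfl⟩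
      simp only [Matrix.cons_val_zero, Matrix.cons_val_one]
      exact ⟨by linarith, by linarith, h3, by nlinarith⟩
  · rw [hi' hp]
    rfl

/-! ### The three-triangle relation -/

/-- **Three-triangle relation** (stub `stub_threeTriangles` of line `odd-hyperbolic-ladder`). For `A = arccos a`,
`B = arccos b` with `A + B ≤ π` (`⇔ 0 ≤ a + b`) and `C = π − A − B` (`cos C = √(1−a²)√(1−b²) − ab`):
`[Std a] + [Std b] + [Std (cos C)] − [Std (−1)] ∈ KZ.relations` for any representations of the four standard
doubly-ideal triangles with integrand `t⁻²`. Moves: ONE boundary rotation by the angle `B` (rule (2), the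
algebraic change of variables `x = cos θ ↦ cos(θ + B)` of `…StubThreeTrianglesAux`) carries `Std a` onto the
V-piece over `(cos(A+B), cos B)`; two vertical cuts (rule (1a)) and one reflection `x ↦ −x` (rule (2), landed
`stub_similarityMove`) do the bookkeeping `[V(c',b)] + [Std b] ≡ [Std c']`, `[Std(−1)] ≡ [V(−1,c')] + [Std c']`,
`[V(−1,c')] ≡ [Std(−c')]` with `c' = cos(A+B) = −cos C`. [cite: KontsevichZagier2001, §1.2 rules (1),(2)] -/
theorem stub_threeTriangles :
    ∀ (V : ℝ → ℝ → ℝ → ℝ → Set (Fin 2 → ℝ)),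
      (∀ α β a c, V α β a c = {p | α < p 0 ∧ p 0 < β ∧ 0 < p 1 ∧ c < (p 0 - a) ^ 2 + p 1 ^ 2}) →
    (∀ α β a c : ℝ, IsAlgebraic ℚ α → IsAlgebraic ℚ β → IsAlgebraic ℚ a → IsAlgebraic ℚ c →
        α < β → (α - a) ^ 2 ≤ c → (β - a) ^ 2 ≤ c →
        ∃ r : KZ.IntegralRep 2, r.domain = V α β a c ∧ r.integrand = fun p => 1 / p 1 ^ 2) →
    ∀ (a b : ℝ), IsAlgebraic ℚ a → IsAlgebraic ℚ b → -1 < a → a < 1 → -1 < b → b < 1 → 0 ≤ a + b →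
    ∀ (ra rb rc rπ : KZ.IntegralRep 2),
      ra.domain = V a 1 0 1 → EqOn ra.integrand (fun p => 1 / p 1 ^ 2) ra.domain →
      rb.domain = V b 1 0 1 → EqOn rb.integrand (fun p => 1 / p 1 ^ 2) rb.domain →
      rc.domain = V (Real.sqrt (1 - a ^ 2) * Real.sqrt (1 - b ^ 2) - a * b) 1 0 1 →
        EqOn rc.integrand (fun p => 1 / p 1 ^ 2) rc.domain →
      rπ.domain = V (-1) 1 0 1 → EqOn rπ.integrand (fun p => 1 / p 1 ^ 2) rπ.domain →
      KZ.of ra + KZ.of rb + KZ.of rc - KZ.of rπ ∈ KZ.relations := by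
  intro V hV _ a b ha hb ha1 ha1' hb1 hb1' hab ra rb rc rπ hra hrai hrb hrbi hrc hrci hrπ hrπi
  rw [hV] at hra hrb hrc hrπ
  -- function symbols for the boundary trigonometry (`S = sin ∘ arccos`, `g, h` the addition theorem, `Φ` the rotation)
  obtain ⟨S, hS⟩ : ∃ S : ℝ → ℝ, ∀ x, S x = Real.sqrt (1 - x ^ 2) := ⟨_, fun _ => rfl⟩
  obtain ⟨g, hg⟩ : ∃ g : ℝ → ℝ → ℝ, ∀ b x, g b x = b * x - S b * S x := ⟨_, fun _ _ => rfl⟩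
  obtain ⟨h, hh⟩ : ∃ h : ℝ → ℝ → ℝ, ∀ b x, h b x = b * S x + S b * x := ⟨_, fun _ _ => rfl⟩
  obtain ⟨Φ, hΦ⟩ : ∃ Φ : ℝ → (Fin 2 → ℝ) → Fin 2 → ℝ,
      ∀ b p, Φ b p = ![g b (p 0), p 1 * (h b (p 0) / S (p 0))] := ⟨_, fun _ _ => rfl⟩
  -- `c' = cos (A + B)`
  set c' : ℝ := g a b with hc'
  have hc'b : c' < b := by
    rw [hc', threeTri_g_comm hg]
    exact threeTri_g_lt_self hS hg hh ha1 ha1' hb1 hb1' hab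
  have hc'1 : -1 ≤ c' := by
    rw [hc', threeTri_g_comm hg]
    exact threeTri_neg_one_le_g hS hg hh ha1.le ha1'.le hb1.le hb1'.le
  have hc'alg : IsAlgebraic ℚ c' := threeTri_isAlgebraic_g hS hg ha hb
  -- the three restrictions of `rπ`
  have hsub1 : {p : Fin 2 → ℝ | c' < p 0 ∧ p 0 < b ∧ 0 < p 1 ∧ 1 < (p 0 - 0) ^ 2 + p 1 ^ 2} ⊆ rπ.domain := by
    rw [hrπ]
    exact fun p hp => ⟨by linarith [hp.1], by linarith [hp.2.1], hp.2.2⟩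
  have hsub2 : {p : Fin 2 → ℝ | c' < p 0 ∧ p 0 < 1 ∧ 0 < p 1 ∧ 1 < (p 0 - 0) ^ 2 + p 1 ^ 2} ⊆ rπ.domain := by
    rw [hrπ]
    exact fun p hp => ⟨by linarith [hp.1], hp.2.1, hp.2.2⟩
  have hsub3 : {p : Fin 2 → ℝ | -1 < p 0 ∧ p 0 < c' ∧ 0 < p 1 ∧ 1 < (p 0 - 0) ^ 2 + p 1 ^ 2} ⊆ rπ.domain := by
    rw [hrπ]
    exact fun p hp => ⟨hp.1, by linarith [hp.2.1], hp.2.2⟩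
  set r1 := rπ.restrict _ (threeTri_isSemialgebraic_V hc'alg hb) hsub1 with hr1
  set r2 := rπ.restrict _ (threeTri_isSemialgebraic_V hc'alg isAlgebraic_one) hsub2 with hr2
  set r3 := rπ.restrict _ (threeTri_isSemialgebraic_V (isAlgebraic_one.neg) hc'alg) hsub3 with hr3
  have hr1i : EqOn r1.integrand (fun p => 1 / p 1 ^ 2) r1.domain := fun p hp => hrπi (hsub1 hp)
  have hr2i : EqOn r2.integrand (fun p => 1 / p 1 ^ 2) r2.domain := fun p hp => hrπi (hsub2 hp)
  have hr3i : EqOn r3.integrand (fun p => 1 / p 1 ^ 2) r3.domain := fun p hp => hrπi (hsub3 hp)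
  -- E₁: the rotation `Std a → V(c', b)`
  have E1 : KZ.of ra - KZ.of r1 ∈ KZ.relations :=
    threeTri_rotationMove S g h Φ hS hg hh hΦ a b hb ha1 ha1' hb1 hb1' hab ra r1 hra hrai rfl hr1i
  -- E₂: cut `V(c', 1)` at `x = b`
  have E2 : KZ.of r2 - KZ.of r1 - KZ.of rb ∈ KZ.relations :=
    threeTri_split hc'b.le hb1'.le r2 r1 rb rfl rfl hrb hr2i hr1i hrbi
  -- E₃: cut `Std(-1)` at `x = c'`
  have E3 : KZ.of rπ - KZ.of r3 - KZ.of r2 ∈ KZ.relations :=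
    threeTri_split hc'1 (hc'b.le.trans hb1'.le) rπ r3 r2 hrπ rfl rfl hrπi hr3i hr2i
  -- E₄: reflect `V(-1, c')` onto `Std(-c')`
  have E4 : KZ.of r3 - KZ.of rc ∈ KZ.relations :=
    threeTri_reflect (α := -1) (β := c') (by rw [hc', hg, hS, hS]; ring) (by norm_num)
      r3 rc rfl hr3i hrc hrci
  have hsum : KZ.of ra + KZ.of rb + KZ.of rc - KZ.of rπ = (KZ.of ra - KZ.of r1) - (KZ.of r2 - KZ.of r1 - KZ.of rb)
      - (KZ.of rπ - KZ.of r3 - KZ.of r2) - (KZ.of r3 - KZ.of rc) := by abel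
  rw [hsum]
  exact sub_mem (sub_mem (sub_mem E1 E2) E3) E4

end Summit.KontsevichZagierPeriods.HyperbolicBloch.OffTetraSectorKernel

end
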